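import Mathlib
import HarnessLib
import Summits.NavierStokesRegularity.NavierStokesRegularity.Theorems.HalfSpaceWindowDoorCirculationCarryingRigidityEddyTorqueStrata
import Summits.NavierStokesRegularity.NavierStokesRegularity.Theorems.AxisTwistDoorAveragedConeLiouvilleGamma34

/-!
# Route `HalfSpaceWindowDoor`, crux `CirculationCarryingRigidity` (stmt-NavierStokesRegularity-25311) — the eddy-torque form of
# Lei–Ren–Tian's one-sided shell inequality (eq. Gamma-34) in the ENERGY class of the sibling route AxisTwistDoor

Line `eddy_torque` (LEAD ns-hsw-p1 g4).  The door `HalfSpaceWindowDoor.Target` is also attacked by route AxisTwistDoor, whose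
crux `AveragedConeLiouville` (26889, PROVED) uses the circle-averaged cone `∮|ω_h| ≤ K∮ω₃` exactly once: in
`…AveragedConeLiouvilleGamma34.gamma34_on_circle`, to turn LRT's circle term into the radial drift `−B(1+K)∂ᵣΓ` on circles
where `|v| ≤ B` (data (H5) of `…UnitContraction.AxisCirculationData`).  This file records, in AxisTwistDoor's own energy-class
vocabulary (`InClass`, `CircleSwirlEquation`, `remainder`), the DRIFT FORM of that inequality under the weaker, ONE-SIDED,
dynamic EDDY-TORQUE hypothesis of this line:

* `gamma34_eddy_on_circle` — if the planner's circle-averaged swirl identity holds and on the circle `S(r,z)` at time `s` the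
  fluctuation remainder (eddy spin-up torque) is slaved to the vertical-vorticity flux, `ℛ ≤ A ∮ω₃ dl`, then
  `∂ₛΓ + v̄_r ∂ᵣΓ + v̄_z ∂_zΓ − ∂_z²Γ − ∂ᵣ²Γ + (r⁻¹ − A) ∂ᵣΓ ≤ 0`: eq. Gamma-34 with the bounded divergence-free axisymmetric
  drift `⟨v⟩_θ = v̄_r e_r + v̄_z e_z` (cf. `…AngularMeanDrift`) kept on the left — the form Nazarov–Ural'tseva's positivity
  propagation (general bounded divergence-free drift) accepts;
* `remainder_le_of_cone_on_circle` — the cone on a circle where `|v| ≤ B` implies the eddy hypothesis with `A = 2B(1+K)`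
  (`…EddyTorqueStrata.abs_remainder_le`), so the drift form contains the cone form.

Purpose: a concrete entry point should the planner re-type AxisTwistDoor's research residue 26991 (`TiltDominationLoc`, the
door's last open crux) from the kinematic cone to the one-sided eddy-torque condition (memo EDDY-TORQUE-g4.md, evidence #14 on
25311).  Seat ns-hsw-p1 g4 (LEAD of 25311, cell pub-ns-dss).  WHAT THIS IS NOT: not a statement about Navier–Stokes regularity
(Clay A): two algebraic lemmas about HYPOTHETICAL blow-up profiles; nothing of AxisTwistDoor is re-registered or closed here;
helper `--supports` 25311.
-/

noncomputable section

-- the summit and its single sub-problem share the name (CONVENTIONS §1), as in every Theorems file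
set_option linter.dupNamespace false

namespace Summit.NavierStokesRegularity.NavierStokesRegularity.Theorems.HalfSpaceWindowDoorCirculationCarryingRigidityEddyTorqueEnergyClass

open MeasureTheory Set Function Filter Topology TopologicalSpace InnerProductSpace WithLp Metric
open scoped RealInnerProductSpace ContDiff
open Literature.Analysis Literature.Analysis.FluidPDE
open Summit.NavierStokesRegularity.NavierStokesRegularity.Theorems.AxisTwistDoorAveragedConeLiouvilleDefs
  (cylPt circ vortCirc radVortCirc tiltCirc meanR meanZ remainder CircleSwirlEquation InClass SignE3)
open Summit.NavierStokesRegularity.NavierStokesRegularity.Theorems.AxisTwistDoorAveragedConeLiouvilleCircleToolkit (contDiff_slice)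
open Summit.NavierStokesRegularity.NavierStokesRegularity.Theorems.HalfSpaceWindowDoorCirculationCarryingRigidityEddyTorqueStrata
  (abs_remainder_le)

variable {C : ℝ} {v : ℝ → EuclideanSpace ℝ (Fin 3) → EuclideanSpace ℝ (Fin 3)}
  {π : ℝ → EuclideanSpace ℝ (Fin 3) → ℝ}
  {H : ℝ → EuclideanSpace ℝ (Fin 3) → EuclideanSpace ℝ (Fin 3) →L[ℝ] EuclideanSpace ℝ (Fin 3)}

/-- **Eq. Gamma-34 in DRIFT FORM under the one-sided eddy-torque hypothesis.**  If the circle-averaged swirl identity holds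
and on the circle `S(r,z)` at time `s < 0` the fluctuation remainder satisfies `ℛ ≤ A ∮ω₃ dl`, then
`∂ₛΓ + v̄_r ∂ᵣΓ + v̄_z ∂_zΓ − ∂_z²Γ − ∂ᵣ²Γ + (r⁻¹ − A) ∂ᵣΓ ≤ 0` there. -/
theorem gamma34_eddy_on_circle (hcse : CircleSwirlEquation v) {s r z A : ℝ} (hs : s < 0) (hr : 0 < r)
    (heddy : remainder v r z s ≤ A * vortCirc v r z s) :
    deriv (fun s' => circ v r z s') s
        + meanR v r z s * deriv (fun r' => circ v r' z s) r + meanZ v r z s * deriv (fun z' => circ v r z' s) z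
      - deriv (fun z' => deriv (fun z'' => circ v r z'' s) z') z
      - deriv (fun r' => deriv (fun r'' => circ v r'' z s) r') r
      + (r⁻¹ - A) * deriv (fun r' => circ v r' z s) r ≤ 0 := by
  obtain ⟨h1, h2⟩ := hcse s hs r hr z
  rw [h1] at h2 ⊢
  nlinarith [h2, heddy]

/-- **The cone implies the eddy hypothesis on a circle** (energy class): for a class profile with `ω₃ ≥ 0`, on a circle where
`∮|ω_h| dl ≤ K ∮ω₃ dl` and `|v(s)| ≤ B`, `ℛ ≤ 2B(1+K) ∮ω₃ dl`. -/
theorem remainder_le_of_cone_on_circle (h : InClass C v π H) (hsign : SignE3 v) {s r z K B : ℝ} (hs : s < 0) (hr : 0 < r)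
    (hcone : tiltCirc v r z s ≤ K * vortCirc v r z s) (hB : ∀ θ : ℝ, ‖v s (cylPt r θ z)‖ ≤ B) :
    remainder v r z s ≤ 2 * B * (1 + K) * vortCirc v r z s := by
  have hv1 : ContDiff ℝ 1 (v s) := (contDiff_slice h hs).of_le (by norm_cast)
  have hB0 : 0 ≤ B := (norm_nonneg _).trans (hB 0)
  have habs := abs_remainder_le (v := v) hv1 (fun y => hsign s hs y) hr.le hB
  have hle : remainder v r z s ≤ 2 * B * (vortCirc v r z s + tiltCirc v r z s) := (le_abs_self _).trans habs
  have : vortCirc v r z s + tiltCirc v r z s ≤ (1 + K) * vortCirc v r z s := by linarith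
  calc remainder v r z s ≤ 2 * B * (vortCirc v r z s + tiltCirc v r z s) := hle
    _ ≤ 2 * B * ((1 + K) * vortCirc v r z s) := mul_le_mul_of_nonneg_left this (by positivity)
    _ = 2 * B * (1 + K) * vortCirc v r z s := by ring

/-- **The cone form of Gamma-34, recovered in drift form**: under the cone and `|v| ≤ B` on the circle,
`∂ₛΓ + v̄_r ∂ᵣΓ + v̄_z ∂_zΓ − ∂_z²Γ − ∂ᵣ²Γ + (r⁻¹ − 2B(1+K)) ∂ᵣΓ ≤ 0`. -/
theorem gamma34_drift_of_cone (h : InClass C v π H) (hsign : SignE3 v) (hcse : CircleSwirlEquation v)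
    {s r z K B : ℝ} (hs : s < 0) (hr : 0 < r)
    (hcone : tiltCirc v r z s ≤ K * vortCirc v r z s) (hB : ∀ θ : ℝ, ‖v s (cylPt r θ z)‖ ≤ B) :
    deriv (fun s' => circ v r z s') s
        + meanR v r z s * deriv (fun r' => circ v r' z s) r + meanZ v r z s * deriv (fun z' => circ v r z' s) z
      - deriv (fun z' => deriv (fun z'' => circ v r z'' s) z') z
      - deriv (fun r' => deriv (fun r'' => circ v r'' z s) r') r
      + (r⁻¹ - 2 * B * (1 + K)) * deriv (fun r' => circ v r' z s) r ≤ 0 :=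
  gamma34_eddy_on_circle hcse hs hr (remainder_le_of_cone_on_circle h hsign hs hr hcone hB)

end Summit.NavierStokesRegularity.NavierStokesRegularity.Theorems.HalfSpaceWindowDoorCirculationCarryingRigidityEddyTorqueEnergyClass

end
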